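import Summits.BirchSwinnertonDyer.Rank2.IntModelLocalData
import Literature.NumberTheory.EllipticCurves.BhargavaHo2022.TwoMarkedPoints
import HarnessLib

/-!
# Cell bsd-rank2 (TWIN leaf `PAdicBSDRankTwoPositiveProportion`, door D-count): the local data of a
# member of Bhargava–Ho's `F₂` read off its integer model `curveInt a`, and their CLASS-CONSTANCY
# on congruence classes of the parameters

Cell-side file (cell bsd-rank2, seat bsd-rank2-lit GEN 10; serves `CountingBridge`
(stmt-BirchSwinnertonDyer-19484) and `GenericMembersLargeF2` of
`route-BirchSwinnertonDyer-CountingDoorF2AtThree`, `HOME/lit/LIT-R2.md` §1w (d) R1/R3). The TWIN leaf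
quantifies over a globally minimal model `C • a.curve` of the member `E_a` (`Params.curve` = the
image of `Params.curveInt`), while a `CongruenceFamily₂` sees only the residues of
`a = (a₁, a₂, a₂', a₃)`. Specialisation of `IntModelLocalData.lean` to `E = curveInt a`, theorems
only (no definition, no fact, no instance), namespace `F2Member`:

* `hasGoodReductionAtPrime_curve`, `frobeniusTrace_smul_curve`, `isOrdinaryAt_smul_curve` — at
  `ℓ ∤ Δ(a)`: good reduction, `a_ℓ(C • E_a) = ℓ + 1 - #(curveInt a)(𝔽_ℓ)`, ordinarity of the minimal
  model iff `ℓ ∤ ℓ + 1 - #(curveInt a)(𝔽_ℓ)` (the leaf's clause at `ℓ = 3`);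
* `hasIrreducibleModPGaloisRep_curve_of_noroot`, `…_smul_curve_of_noroot` — Mazur's Frobenius
  certificate for `E_a[p]` from one good auxiliary prime;
* `haux_smul_curve`, `padicValInt_minimalDiscriminantInt_smul_curve` — `ord_ℓ Δ(a) = 1` (`ℓ ≥ 5`)
  gives the auxiliary-prime hypothesis `haux` of `doorKernel_at_three` on every globally minimal
  model (`ℓ = 5`, `p = 3`);
* CLASS-CONSTANCY: `curveInt_map_eq_of_cast_eq` — the reduction of `curveInt a` modulo `n` depends
  only on `a mod n`; hence `numPointsMod`, `Automorphic.frobeniusTrace`, `n ∣ Δ(a)` and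
  `ord_ℓ Δ(a) = 1` (a condition modulo `ℓ²`) are constant on residue classes
  (`numPointsMod_eq_of_cast_eq`, `frobeniusTrace_eq_of_cast_eq`, `dvd_Δ_iff_of_cast_eq`,
  `Δ_modEq_of_cast_eq`, `padicValInt_Δ_eq_one_iff_of_cast_eq`), and ONE Frobenius certificate at an
  auxiliary good prime `ℓ₁` decides `ρ̄₃`-irreducibility for a whole congruence class of `F₂`
  (`hasIrreducibleModPGaloisRep_smul_curve_of_cast_eq`) — the deterministic replacement (R1) for
  the density-one irreducibility clause of `GenericMembersLargeF2`.

PARTITION: none — r_an ≥ 2, summit axis S0; TWIN (D-0056): n/a. B1 honesty: local algebra of the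
members' Weierstrass models; no Selmer group, `L`-value or analytic rank is mentioned.

References: M. Bhargava, W. Ho, arXiv:2207.03309 §1 (the family `F₂`, congruence subfamilies)
[BhargavaHo2022]; J. H. Silverman, *AEC* (2009) VII.1, VII.5 [SilvermanAEC2009]; B. Mazur,
Invent. Math. 44 (1978) Prop. 6.3 (1) [Mazur1978].
-/

noncomputable section

open scoped Classical

open WeierstrassCurve Literature.NumberTheory.EllipticCurves

namespace Summit.BirchSwinnertonDyer.Rank2

/-! ### The dictionary for a member of `F₂` -/

namespace F2Member

open Literature.NumberTheory.EllipticCurves.BhargavaHo2022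

variable (a : Params)

/-- A member of `F₂` has good reduction at every prime `ℓ ∤ Δ(a)`. [cite: BhargavaHo2022, §1 (the family F₂)] -/
theorem hasGoodReductionAtPrime_curve (ℓ : ℕ) [Fact ℓ.Prime] (hℓΔ : ¬ (ℓ : ℤ) ∣ a.curveInt.Δ) :
    a.curve.HasGoodReductionAtPrime ℓ :=
  hasGoodReductionAtPrime_map_of_not_dvd a.curveInt ℓ hℓΔ

/-- Good reduction and `a_ℓ` of a globally minimal model `C • E_a` of a member of `F₂`, at a
prime `ℓ ∤ Δ(a)`, read off the integer model `curveInt a`: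
`a_ℓ(C • E_a) = ℓ + 1 - #(curveInt a)(𝔽_ℓ)`. [cite: SilvermanAEC2009, Exercise 8.19(a) and Prop. VII.1.3(b)] -/
theorem frobeniusTrace_smul_curve (C : VariableChange ℚ) [hmin : (C • a.curve).IsGloballyMinimal]
    (ℓ : ℕ) [Fact ℓ.Prime] (hℓΔ : ¬ (ℓ : ℤ) ∣ a.curveInt.Δ) :
    (C • a.curve).HasGoodReductionAtPrime ℓ ∧
      (C • a.curve).frobeniusTrace ℓ =
        Literature.NumberTheory.Automorphic.frobeniusTrace a.curveInt ℓ := by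
  haveI : (C • a.curve).IsElliptic := by
    haveI := a.isElliptic_curve (fun h ↦ hℓΔ (h ▸ dvd_zero _))
    infer_instance
  exact frobeniusTrace_eq_of_smul_map_eq a.curveInt (C • a.curve) C rfl ℓ hℓΔ

/-- **Ordinarity at `ℓ` of the minimal model of a member of `F₂`** from its integer model:
`ℓ ∤ Δ(a)` and `ℓ ∤ ℓ + 1 - #(curveInt a)(𝔽_ℓ)` give `IsOrdinaryAt (C • E_a) ℓ` for every globally
minimal `C • E_a` (the leaf's clause at `ℓ = 3`). [cite: SilvermanAEC2009, Exercise 8.19(a) and Prop. VII.1.3(b)] -/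
theorem isOrdinaryAt_smul_curve (C : VariableChange ℚ) [hmin : (C • a.curve).IsGloballyMinimal]
    (ℓ : ℕ) [Fact ℓ.Prime] (hℓΔ : ¬ (ℓ : ℤ) ∣ a.curveInt.Δ)
    (hord : ¬ (ℓ : ℤ) ∣ Literature.NumberTheory.Automorphic.frobeniusTrace a.curveInt ℓ) :
    IsOrdinaryAt (C • a.curve) ℓ := by
  obtain ⟨hgood, htr⟩ := frobeniusTrace_smul_curve a C ℓ hℓΔ
  exact ⟨hgood, by rw [htr]; exact hord⟩

/-- **Frobenius certificate for a member of `F₂`**: a good auxiliary prime `ℓ ∤ Δ(a)`, `ℓ ≠ p`, at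
which `X² - (ℓ + 1 - #(curveInt a)(𝔽_ℓ)) X + ℓ` has no root mod `p` makes `E_a[p]` irreducible.
[cite: Mazur1978, §6 Prop. 6.3 (1) (p. 153)] -/
theorem hasIrreducibleModPGaloisRep_curve_of_noroot (p ℓ : ℕ) [Fact p.Prime] [Fact ℓ.Prime]
    (hℓp : ℓ ≠ p) (hℓΔ : ¬ (ℓ : ℤ) ∣ a.curveInt.Δ)
    (hnoroot : ∀ t : ZMod p,
      t ^ 2 - (Literature.NumberTheory.Automorphic.frobeniusTrace a.curveInt ℓ : ZMod p) * t +
        (ℓ : ZMod p) ≠ 0) :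
    a.curve.HasIrreducibleModPGaloisRep p :=
  hasIrreducibleModPGaloisRep_map_of_noroot a.curveInt p ℓ hℓp hℓΔ hnoroot

/-- The same certificate for every model `C • E_a` (irreducibility of `E[p]` is an isomorphism
invariant, `Mazur1978.hasIrreducibleModPGaloisRep_smul_iff`) — the form the door kernel consumes on the
globally minimal model. [cite: Mazur1978, §6 Prop. 6.3 (1) (p. 153)] -/
theorem hasIrreducibleModPGaloisRep_smul_curve_of_noroot (C : VariableChange ℚ) (p ℓ : ℕ)
    [Fact p.Prime] [Fact ℓ.Prime] (hℓp : ℓ ≠ p) (hℓΔ : ¬ (ℓ : ℤ) ∣ a.curveInt.Δ)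
    (hnoroot : ∀ t : ZMod p,
      t ^ 2 - (Literature.NumberTheory.Automorphic.frobeniusTrace a.curveInt ℓ : ZMod p) * t +
        (ℓ : ZMod p) ≠ 0) :
    (C • a.curve).HasIrreducibleModPGaloisRep p :=
  (Mazur1978.hasIrreducibleModPGaloisRep_smul_iff a.curve C p).mpr
    (hasIrreducibleModPGaloisRep_curve_of_noroot a p ℓ hℓp hℓΔ hnoroot)

/-- **The auxiliary-prime clause for a member of `F₂`**: if `ord_ℓ Δ(a) = 1` at a prime `ℓ ≥ 5`
(e.g. `ord₅ Δ(a) = 1`, a congruence condition modulo `25`), then every globally minimal model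
`C • E_a` has multiplicative reduction at `ℓ` with `ord_ℓ Δ_min = 1`, whence the hypothesis `haux`
of `doorKernel_at_three` (`p = 3`, `ℓ = 5`). [cite: SilvermanAEC2009, VII.5 Prop. 5.1(b) and VII.1 Prop. 1.3(b)] -/
theorem haux_smul_curve (C : VariableChange ℚ) [hmin : (C • a.curve).IsGloballyMinimal] {ℓ : ℕ}
    [Fact ℓ.Prime] (h5 : 5 ≤ ℓ) (h1 : padicValInt ℓ a.curveInt.Δ = 1) (p : ℕ) (hp : p.Prime)
    (hℓp : ℓ ≠ p) :
    ∃ ℓ' : ℕ, ∃ _ : Fact ℓ'.Prime, ℓ' ≠ p ∧ (C • a.curve).HasMultiplicativeReductionAtPrime ℓ' ∧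
      ¬ p ∣ padicValInt ℓ' (C • a.curve).minimalDiscriminantInt := by
  haveI : (C • a.curve).IsElliptic := by
    haveI := a.isElliptic_curve (fun h ↦ by rw [h, padicValInt.zero] at h1; exact zero_ne_one h1)
    infer_instance
  exact haux_of_padicValInt_Δ_eq_one a.curveInt (C • a.curve) C rfl h5 h1 p hp hℓp

/-- `ord_ℓ Δ_min(C • E_a) = ord_ℓ Δ(a)` whenever `ord_ℓ Δ(a) < 12` (in particular at every prime of
the conditions `3 ∤ Δ(a)`, `ord₅ Δ(a) = 1`). [cite: SilvermanAEC2009, VII.1 Prop. 1.3(b) with Rem. 1.1 (p. 186)] -/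
theorem padicValInt_minimalDiscriminantInt_smul_curve (C : VariableChange ℚ)
    [hmin : (C • a.curve).IsGloballyMinimal] (ha : a.IsMember) {ℓ : ℕ} [Fact ℓ.Prime]
    (hlt : padicValInt ℓ a.curveInt.Δ < 12) :
    padicValInt ℓ (C • a.curve).minimalDiscriminantInt = padicValInt ℓ a.curveInt.Δ := by
  haveI : (C • a.curve).IsElliptic := by
    haveI := a.isElliptic_curve ha
    infer_instance
  exact padicValInt_minimalDiscriminantInt_eq_of_smul_map_eq a.curveInt (C • a.curve) C rfl ha hlt

/-! ### Class-constancy: the reduction of `curveInt a` modulo `n` depends only on `a mod n` -/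

variable {a} {r : Params} {n : ℕ}

/-- The reduction modulo `n` of the integer model of a member of `F₂` depends only on the residues
of the parameters `(a₁, a₂, a₂', a₃)` modulo `n` (its coefficients are integer polynomials in the
parameters). [cite: BhargavaHo2022, §1 (subfamilies defined by congruence conditions)] -/
theorem curveInt_map_eq_of_cast_eq (h₁ : (a.a₁ : ZMod n) = r.a₁) (h₂ : (a.a₂ : ZMod n) = r.a₂)
    (h₂' : (a.a₂' : ZMod n) = r.a₂') (h₃ : (a.a₃ : ZMod n) = r.a₃) :
    a.curveInt.map (Int.castRingHom (ZMod n)) = r.curveInt.map (Int.castRingHom (ZMod n)) := by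
  ext <;> simp [Params.curveInt, WeierstrassCurve.map, h₁, h₂, h₂', h₃]

/-- Hence the point count modulo `n` is constant on residue classes modulo `n`.
[cite: BhargavaHo2022, §1 (subfamilies defined by congruence conditions)] -/
theorem numPointsMod_eq_of_cast_eq (h₁ : (a.a₁ : ZMod n) = r.a₁) (h₂ : (a.a₂ : ZMod n) = r.a₂)
    (h₂' : (a.a₂' : ZMod n) = r.a₂') (h₃ : (a.a₃ : ZMod n) = r.a₃) :
    Literature.NumberTheory.Automorphic.numPointsMod a.curveInt n =
      Literature.NumberTheory.Automorphic.numPointsMod r.curveInt n := by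
  unfold Literature.NumberTheory.Automorphic.numPointsMod
  rw [curveInt_map_eq_of_cast_eq h₁ h₂ h₂' h₃]

/-- Hence `ℓ + 1 - #E_a(𝔽_n)` is constant on residue classes modulo `n`.
[cite: BhargavaHo2022, §1 (subfamilies defined by congruence conditions)] -/
theorem frobeniusTrace_eq_of_cast_eq (h₁ : (a.a₁ : ZMod n) = r.a₁) (h₂ : (a.a₂ : ZMod n) = r.a₂)
    (h₂' : (a.a₂' : ZMod n) = r.a₂') (h₃ : (a.a₃ : ZMod n) = r.a₃) :
    Literature.NumberTheory.Automorphic.frobeniusTrace a.curveInt n =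
      Literature.NumberTheory.Automorphic.frobeniusTrace r.curveInt n := by
  unfold Literature.NumberTheory.Automorphic.frobeniusTrace
  rw [numPointsMod_eq_of_cast_eq h₁ h₂ h₂' h₃]

/-- Hence `n ∣ Δ(a)` is constant on residue classes modulo `n`.
[cite: BhargavaHo2022, §1 (subfamilies defined by congruence conditions)] -/
theorem dvd_Δ_iff_of_cast_eq (h₁ : (a.a₁ : ZMod n) = r.a₁) (h₂ : (a.a₂ : ZMod n) = r.a₂)
    (h₂' : (a.a₂' : ZMod n) = r.a₂') (h₃ : (a.a₃ : ZMod n) = r.a₃) :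
    (n : ℤ) ∣ a.curveInt.Δ ↔ (n : ℤ) ∣ r.curveInt.Δ := by
  have h := congrArg WeierstrassCurve.Δ (curveInt_map_eq_of_cast_eq h₁ h₂ h₂' h₃)
  simp only [map_Δ, eq_intCast] at h
  rw [← ZMod.intCast_zmod_eq_zero_iff_dvd, ← ZMod.intCast_zmod_eq_zero_iff_dvd, h]

/-- The discriminants of two members in the same residue class modulo `n` are congruent modulo `n`.
[cite: BhargavaHo2022, §1 (subfamilies defined by congruence conditions)] -/
theorem Δ_modEq_of_cast_eq (h₁ : (a.a₁ : ZMod n) = r.a₁) (h₂ : (a.a₂ : ZMod n) = r.a₂)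
    (h₂' : (a.a₂' : ZMod n) = r.a₂') (h₃ : (a.a₃ : ZMod n) = r.a₃) :
    a.curveInt.Δ ≡ r.curveInt.Δ [ZMOD n] := by
  have h := congrArg WeierstrassCurve.Δ (curveInt_map_eq_of_cast_eq h₁ h₂ h₂' h₃)
  simp only [map_Δ, eq_intCast] at h
  exact (ZMod.intCast_eq_intCast_iff _ _ _).mp h

/-- Hence `ord_ℓ Δ(a) = 1` is constant on residue classes modulo `ℓ²` (the shape of the condition
"`ord₅ Δ = 1`", a congruence condition modulo `25`).
[cite: BhargavaHo2022, §1 (subfamilies defined by congruence conditions)] -/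
theorem padicValInt_Δ_eq_one_iff_of_cast_eq {ℓ : ℕ} [Fact ℓ.Prime]
    (h₁ : (a.a₁ : ZMod (ℓ ^ 2)) = r.a₁) (h₂ : (a.a₂ : ZMod (ℓ ^ 2)) = r.a₂)
    (h₂' : (a.a₂' : ZMod (ℓ ^ 2)) = r.a₂') (h₃ : (a.a₃ : ZMod (ℓ ^ 2)) = r.a₃) :
    padicValInt ℓ a.curveInt.Δ = 1 ↔ padicValInt ℓ r.curveInt.Δ = 1 := by
  have hmod : a.curveInt.Δ ≡ r.curveInt.Δ [ZMOD ((ℓ ^ 2 : ℕ) : ℤ)] := Δ_modEq_of_cast_eq h₁ h₂ h₂' h₃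
  have hsub : ((ℓ : ℤ) ^ 2) ∣ r.curveInt.Δ - a.curveInt.Δ := by
    have h := Int.ModEq.dvd hmod
    push_cast at h
    exact h
  have key : ∀ {d : ℤ}, d ∣ (ℓ : ℤ) ^ 2 → (d ∣ a.curveInt.Δ ↔ d ∣ r.curveInt.Δ) := fun hd ↦ by
    have hd' := hd.trans hsub
    constructor
    · intro h
      have h' := dvd_add h hd'
      rwa [add_sub_cancel] at h'
    · intro h
      have h' := dvd_sub h hd'
      rwa [sub_sub_cancel] at h'
  rw [padicValInt_eq_one_iff, padicValInt_eq_one_iff, key (dvd_pow_self (ℓ : ℤ) two_ne_zero),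
    key dvd_rfl]

/-- **One Frobenius certificate per congruence class** (the deterministic replacement R1 for the
density-one irreducibility clause of `GenericMembersLargeF2`): if the representative `r` has a good
auxiliary prime `ℓ ∤ Δ(r)`, `ℓ ≠ p`, at which `X² - (ℓ + 1 - #E_r(𝔽_ℓ)) X + ℓ` is root-free mod
`p`, then EVERY member `a ≡ r (mod ℓ)` of `F₂` has irreducible `E_a[p]`, on every model `C • E_a`.
[cite: Mazur1978, §6 Prop. 6.3 (1) (p. 153)] -/
theorem hasIrreducibleModPGaloisRep_smul_curve_of_cast_eq (C : VariableChange ℚ) (p ℓ : ℕ)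
    [Fact p.Prime] [Fact ℓ.Prime] (hℓp : ℓ ≠ p)
    (h₁ : (a.a₁ : ZMod ℓ) = r.a₁) (h₂ : (a.a₂ : ZMod ℓ) = r.a₂)
    (h₂' : (a.a₂' : ZMod ℓ) = r.a₂') (h₃ : (a.a₃ : ZMod ℓ) = r.a₃)
    (hℓΔ : ¬ (ℓ : ℤ) ∣ r.curveInt.Δ)
    (hnoroot : ∀ t : ZMod p,
      t ^ 2 - (Literature.NumberTheory.Automorphic.frobeniusTrace r.curveInt ℓ : ZMod p) * t +
        (ℓ : ZMod p) ≠ 0) :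
    (C • a.curve).HasIrreducibleModPGaloisRep p :=
  hasIrreducibleModPGaloisRep_smul_curve_of_noroot a C p ℓ hℓp
    (by rw [dvd_Δ_iff_of_cast_eq h₁ h₂ h₂' h₃]; exact hℓΔ)
    (by rw [frobeniusTrace_eq_of_cast_eq h₁ h₂ h₂' h₃]; exact hnoroot)

end F2Member

end Summit.BirchSwinnertonDyer.Rank2

end
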